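import Literature.NumberTheory.GaloisRepresentations.MaxUnramifiedIntegers
import Literature.NumberTheory.GaloisRepresentations.FrobeniusGeneration
import Mathlib.RingTheory.RootsOfUnity.AlgebraicallyClosed
import Mathlib.FieldTheory.Finite.Basic
import HarnessLib

/-!
# `Gal(F̄/F)/I_F` is torsion-free: `σ^m ∈ I_F ⇒ σ ∈ I_F` for a non-archimedean local field `F`

For a non-archimedean local field `F` (Mathlib `IsNonarchimedeanLocalField`, the tree's valued
model) with absolute inertia group `I_F = absInertia F ≤ Γ_F = Gal(F̄/F)` (`LocalGaloisGroup.lean`),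
the quotient `Γ_F/I_F ≅ Gal(k̄/k) ≅ Ẑ` is torsion-free (Serre, *Local Fields*, Ch. I §7–8,
Ch. IV §4: `Gal(F_nr/F) ≅ Gal(k̄/k) = Ẑ`, topologically generated by the Frobenius).  This
proof-only file establishes the torsion-freeness in the elementary form

* `mem_absInertia_of_pow_mem`: if `σ ^ m ∈ I_F` for some `m ≥ 1` then `σ ∈ I_F`,

without developing `Ẑ`: `σ` acts on the (algebraically closed) residue field `k̄ = S/𝔓` as a
`k`-automorphism `σ̄`, which on any finite set is a power `x ↦ x^{q^a}` of the Frobenius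
(`exists_forall_algEquiv_apply_eq_pow`, `FrobeniusGeneration.lean`); testing `σ̄^m = 1` on a
primitive `(q^{mE} - 1)`-th root of unity `ω` of `k̄` (whose powers contain a given `x` with
`x^{q^E} = x`) forces `mE ∣ am`, hence `E ∣ a` and `σ̄ x = x`.

Purpose (abc-iut L4): this is the input "every prime-to-`p` torsion element of `G_K^ab` lies in
the image of inertia" of the named fact `mlf_torsion_card` (`MLFReciprocityInputs.lean`, [AbsAnab]
Prop 1.2.1 (iii)/(v)), to be combined with the tree's PROVED reciprocity map
(`exists_isLocalReciprocityMap_holds`).  Proof-only: no definitions.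
-/

noncomputable section

open scoped Pointwise Valued
open ValuativeRel Field

namespace Literature.NumberTheory.GaloisRepresentations

open GaloisRepresentations.IsNonarchimedeanLocalField

/-- Elementary arithmetic: for `q ≥ 2`, `M ≥ 1`, if `q ^ M - 1 ∣ q ^ b - 1` then `M ∣ b` (the order
of `q` modulo `q^M - 1` is `M`). [folklore] -/
private theorem dvd_of_pow_sub_one_dvd {q M b : ℕ} (hq : 2 ≤ q) (hM : 0 < M)
    (h : q ^ M - 1 ∣ q ^ b - 1) : M ∣ b := by
  -- write `b = s * M + r`, `r < M`; then `q^M - 1 ∣ q^r - 1 < q^M - 1`, so `r = 0`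
  obtain ⟨s, r, hr, rfl⟩ : ∃ s r, r < M ∧ b = M * s + r :=
    ⟨b / M, b % M, Nat.mod_lt b hM, (Nat.div_add_mod b M).symm⟩
  have h1 : q ^ M - 1 ∣ q ^ (M * s) - 1 := Nat.pow_sub_one_dvd_pow_sub_one q (dvd_mul_right M s)
  have hq0 : 0 < q := by omega
  have hqsM : 1 ≤ q ^ (M * s) := Nat.one_le_pow _ _ hq0
  have hqr : 1 ≤ q ^ r := Nat.one_le_pow _ _ hq0
  have hsplit : q ^ (M * s + r) - 1 = (q ^ (M * s) - 1) * q ^ r + (q ^ r - 1) := by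
    rw [pow_add]
    zify [hqsM, hqr, Nat.one_le_pow (M * s + r) q hq0, Nat.mul_le_mul hqsM hqr]
    ring
  rw [hsplit] at h
  have h2 : q ^ M - 1 ∣ q ^ r - 1 := (Nat.dvd_add_right (h1.mul_right _)).mp h
  have hlt : q ^ r - 1 < q ^ M - 1 := by
    have : q ^ r < q ^ M := Nat.pow_lt_pow_right (by omega) hr
    omega
  have hr0 : q ^ r - 1 = 0 := Nat.eq_zero_of_dvd_of_lt h2 hlt
  have hr1 : q ^ r = 1 := by omega
  have : r = 0 := by
    rcases Nat.eq_zero_or_pos r with h0 | hpos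
    · exact h0
    · exfalso
      have : q ≤ q ^ r := Nat.le_self_pow hpos.ne' q
      omega
  subst this
  simp

variable {F : Type*} [Field F] [ValuativeRel F] [TopologicalSpace F] [IsNonarchimedeanLocalField F]

-- the tower of quotient fields `𝒪[F] ⧸ 𝔓 ∩ 𝒪[F] → S ⧸ 𝔓` (local `Ideal.Quotient.field` instances)
-- makes instance synthesis slow, as in `WeilGroupDensityProofs.lean`
set_option maxHeartbeats 800000 in
set_option synthInstance.maxHeartbeats 100000 in
/-- **`Γ_F/I_F` is torsion-free**: if `σ ∈ Gal(F̄/F)` and `σ ^ m ∈ I_F` for some `m ≥ 1`, then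
`σ ∈ I_F`.  (`Γ_F/I_F = Gal(k̄/k) ≅ Ẑ`; Serre, *Local Fields*, Ch. IV §4, Cor. 2 to Prop. 16,
and Ch. XIII §4: the unramified quotient is procyclic on the Frobenius.)
[cite: SerreLocalFields1979, Ch. IV §4 Cor. 2 to Prop. 16] -/
theorem mem_absInertia_of_pow_mem {σ : absoluteGaloisGroup F} {m : ℕ} (hm : 0 < m)
    (hσm : σ ^ m ∈ absInertia F) : σ ∈ absInertia F := by
  classical
  -- the residue fields `(absIntegers 𝒪[F] F ⧸ absMaximalIdeal F) = S ⧸ 𝔓` (algebraically closed) and `(𝒪[F] ⧸ (absMaximalIdeal F).under 𝒪[F]) = 𝒪[F] ⧸ 𝔓 ∩ 𝒪[F]` (`(residueFieldCard F)` elements)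
  haveI h𝔓 : (absMaximalIdeal F).IsMaximal := absMaximalIdeal_isMaximal_holds F
  letI := Ideal.Quotient.field (absMaximalIdeal F)
  haveI : ((absMaximalIdeal F).under 𝒪[F]).IsMaximal := Ideal.IsMaximal.under 𝒪[F] _
  letI := Ideal.Quotient.field ((absMaximalIdeal F).under 𝒪[F])
  haveI : Finite (𝒪[F] ⧸ (absMaximalIdeal F).under 𝒪[F]) := Nat.finite_of_card_ne_zero (by
    rw [card_quotient_under_absMaximalIdeal_holds F]
    exact residueFieldCard_ne_zero F)
  letI : Fintype (𝒪[F] ⧸ (absMaximalIdeal F).under 𝒪[F]) := Fintype.ofFinite _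
  have hq : Fintype.card (𝒪[F] ⧸ (absMaximalIdeal F).under 𝒪[F]) = residueFieldCard F := by
    rw [Fintype.card_eq_nat_card, card_quotient_under_absMaximalIdeal_holds F]
  have hq2 : 2 ≤ residueFieldCard F := one_lt_residueFieldCard F
  haveI : IsAlgClosed (absIntegers 𝒪[F] F ⧸ absMaximalIdeal F) :=
    isAlgClosed_quotient_absMaximalIdeal F
  -- `((residueFieldCard F) : (absIntegers 𝒪[F] F ⧸ absMaximalIdeal F)) = 0`
  have hqR : ((residueFieldCard F) : (absIntegers 𝒪[F] F ⧸ absMaximalIdeal F)) = 0 := by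
    rw [← hq, ← map_natCast (algebraMap (𝒪[F] ⧸ (absMaximalIdeal F).under 𝒪[F]) (absIntegers 𝒪[F] F ⧸ absMaximalIdeal F)), FiniteField.cast_card_eq_zero, map_zero]
  -- `σ` acting on `(absIntegers 𝒪[F] F ⧸ absMaximalIdeal F)` as a `(𝒪[F] ⧸ (absMaximalIdeal F).under 𝒪[F])`-automorphism `ρ`, and `ρ^m = 1`
  have hσst : σ ∈ MulAction.stabilizer (absoluteGaloisGroup F) (absMaximalIdeal F) :=
    smul_absMaximalIdeal_holds F σ
  let ρ : (absIntegers 𝒪[F] F ⧸ absMaximalIdeal F) ≃ₐ[(𝒪[F] ⧸ (absMaximalIdeal F).under 𝒪[F])] (absIntegers 𝒪[F] F ⧸ absMaximalIdeal F) := Ideal.Quotient.stabilizerHom (absMaximalIdeal F)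
    ((absMaximalIdeal F).under 𝒪[F]) (absoluteGaloisGroup F) ⟨σ, hσst⟩
  have hρ : ∀ x : absIntegers 𝒪[F] F,
      ρ (Ideal.Quotient.mk _ x) = Ideal.Quotient.mk _ (σ • x) := fun x =>
    Ideal.Quotient.stabilizerHom_apply _ _ _ ⟨σ, hσst⟩ x
  have hρpow : ∀ (j : ℕ) (x : absIntegers 𝒪[F] F),
      (ρ ^ j) (Ideal.Quotient.mk _ x) = Ideal.Quotient.mk _ ((σ ^ j) • x) := by
    intro j
    induction j with
    | zero => intro x; simp
    | succ j ih =>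
      intro x
      rw [pow_succ, AlgEquiv.mul_apply, hρ, ih, ← mul_smul, ← pow_succ]
  have hρm : ∀ y : (absIntegers 𝒪[F] F ⧸ absMaximalIdeal F), (ρ ^ m) y = y := by
    intro y
    obtain ⟨x, rfl⟩ := Ideal.Quotient.mk_surjective y
    rw [hρpow, Ideal.Quotient.eq]
    exact (mem_absInertia_iff.mp hσm) x
  -- goal: `σ` fixes every residue
  rw [mem_absInertia_iff]
  intro b
  rw [← Ideal.Quotient.eq, ← hρ]
  set x : (absIntegers 𝒪[F] F ⧸ absMaximalIdeal F) := Ideal.Quotient.mk _ b with hxdef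
  by_cases hx0 : x = 0
  · rw [hx0, map_zero]
  -- `x` lies in a finite subfield: `x ^ ((residueFieldCard F) ^ E) = x` with `E ≥ 1`
  obtain ⟨E, hE, hxE⟩ : ∃ E : ℕ, 0 < E ∧ x ^ ((residueFieldCard F) ^ E) = x := by
    let k₁ : IntermediateField (𝒪[F] ⧸ (absMaximalIdeal F).under 𝒪[F]) (absIntegers 𝒪[F] F ⧸ absMaximalIdeal F) := IntermediateField.adjoin (𝒪[F] ⧸ (absMaximalIdeal F).under 𝒪[F]) {x}
    haveI : FiniteDimensional (𝒪[F] ⧸ (absMaximalIdeal F).under 𝒪[F]) k₁ :=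
      IntermediateField.adjoin.finiteDimensional (Algebra.IsIntegral.isIntegral x)
    haveI : Finite k₁ := Module.finite_of_finite (𝒪[F] ⧸ (absMaximalIdeal F).under 𝒪[F])
    letI : Fintype k₁ := Fintype.ofFinite _
    have h1 : Fintype.card k₁ = (residueFieldCard F) ^
        Module.finrank (𝒪[F] ⧸ (absMaximalIdeal F).under 𝒪[F]) k₁ := by
      rw [Module.card_eq_pow_finrank (K := (𝒪[F] ⧸ (absMaximalIdeal F).under 𝒪[F])) (V := k₁),
        hq]
    have hpos : 0 < Module.finrank (𝒪[F] ⧸ (absMaximalIdeal F).under 𝒪[F]) k₁ := by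
      by_contra h0
      rw [Nat.not_lt, Nat.le_zero] at h0
      rw [h0, pow_zero] at h1
      exact absurd h1 Fintype.one_lt_card.ne'
    refine ⟨Module.finrank (𝒪[F] ⧸ (absMaximalIdeal F).under 𝒪[F]) k₁, hpos, ?_⟩
    have h2 := FiniteField.pow_card
      (⟨x, IntermediateField.mem_adjoin_simple_self (𝒪[F] ⧸ (absMaximalIdeal F).under 𝒪[F]) x⟩ :
        k₁)
    rw [h1] at h2
    exact congrArg Subtype.val h2
  -- a primitive `((residueFieldCard F)^(mE) - 1)`-th root of unity `ω` of `(absIntegers 𝒪[F] F ⧸ absMaximalIdeal F)`; `x` is a power of `ω`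
  set n₀ : ℕ := (residueFieldCard F) ^ (m * E) - 1 with hn₀
  have hqmE : 1 ≤ (residueFieldCard F) ^ (m * E) := Nat.one_le_pow _ _ (by omega)
  have hn₀pos : 0 < n₀ := by
    have : 1 < (residueFieldCard F) ^ (m * E) := Nat.one_lt_pow (Nat.mul_pos hm hE).ne' hq2
    omega
  haveI : NeZero n₀ := ⟨hn₀pos.ne'⟩
  haveI : NeZero (n₀ : (absIntegers 𝒪[F] F ⧸ absMaximalIdeal F)) := ⟨by
    rw [hn₀, Nat.cast_sub hqmE, Nat.cast_pow, hqR, zero_pow (Nat.mul_pos hm hE).ne',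
      Nat.cast_one, zero_sub]
    exact neg_ne_zero.mpr one_ne_zero⟩
  obtain ⟨ω, hω⟩ := HasEnoughRootsOfUnity.prim (M := (absIntegers 𝒪[F] F ⧸ absMaximalIdeal F)) (n := n₀)
  have hxn₀ : x ^ n₀ = 1 := by
    -- `x ^ ((residueFieldCard F)^E - 1) = 1` and `(residueFieldCard F)^E - 1 ∣ (residueFieldCard F)^(mE) - 1`
    have hqE : 1 ≤ (residueFieldCard F) ^ E := Nat.one_le_pow _ _ (by omega)
    have h1 : x ^ ((residueFieldCard F) ^ E - 1) = 1 := by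
      have : x ^ ((residueFieldCard F) ^ E - 1) * x = x := by rw [← pow_succ, Nat.sub_add_cancel hqE, hxE]
      exact mul_left_eq_self₀.mp this |>.resolve_right hx0
    have hdvd : (residueFieldCard F) ^ E - 1 ∣ n₀ := Nat.pow_sub_one_dvd_pow_sub_one (residueFieldCard F) (dvd_mul_left E m)
    obtain ⟨c, hc⟩ := hdvd
    rw [hc, pow_mul, h1, one_pow]
  obtain ⟨i, -, hix⟩ := hω.eq_pow_of_pow_eq_one hxn₀
  -- `ρ` acts on `ω` as `ω ↦ ω ^ ((residueFieldCard F) ^ a)`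
  obtain ⟨a, ha⟩ := exists_forall_algEquiv_apply_eq_pow ρ {ω}
  have hρω : ρ ω = ω ^ ((residueFieldCard F) ^ a) := by rw [ha ω (Finset.mem_singleton_self ω), hq]
  have hρjω : ∀ j : ℕ, (ρ ^ j) ω = ω ^ ((residueFieldCard F) ^ (a * j)) := by
    intro j
    induction j with
    | zero => simp
    | succ j ih => rw [pow_succ, AlgEquiv.mul_apply, hρω, map_pow, ih, ← pow_mul, ← pow_add,
        Nat.mul_succ]
  -- `ρ^m = 1` on `ω` gives `n₀ ∣ (residueFieldCard F)^(am) - 1`, hence `mE ∣ am`, hence `E ∣ a`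
  have hω0 : ω ≠ 0 := hω.ne_zero (NeZero.ne n₀)
  have hdvd : n₀ ∣ (residueFieldCard F) ^ (a * m) - 1 := by
    have h1 : ω ^ ((residueFieldCard F) ^ (a * m)) = ω := by rw [← hρjω, hρm]
    have hqam : 1 ≤ (residueFieldCard F) ^ (a * m) := Nat.one_le_pow _ _ (by omega)
    rw [← hω.pow_eq_one_iff_dvd]
    have : ω ^ ((residueFieldCard F) ^ (a * m) - 1) * ω = ω := by rw [← pow_succ, Nat.sub_add_cancel hqam, h1]
    exact (mul_left_eq_self₀.mp this).resolve_right hω0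
  have hEa : E ∣ a := by
    have h1 : m * E ∣ a * m := dvd_of_pow_sub_one_dvd hq2 (Nat.mul_pos hm hE) hdvd
    rw [mul_comm a m] at h1
    exact Nat.dvd_of_mul_dvd_mul_left hm h1
  -- hence `x ^ ((residueFieldCard F) ^ a) = x` and `ρ x = x`
  have hxa : x ^ ((residueFieldCard F) ^ a) = x := by
    have hqE : 1 ≤ (residueFieldCard F) ^ E := Nat.one_le_pow _ _ (by omega)
    have hqa : 1 ≤ (residueFieldCard F) ^ a := Nat.one_le_pow _ _ (by omega)
    have h1 : x ^ ((residueFieldCard F) ^ E - 1) = 1 := by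
      have : x ^ ((residueFieldCard F) ^ E - 1) * x = x := by rw [← pow_succ, Nat.sub_add_cancel hqE, hxE]
      exact (mul_left_eq_self₀.mp this).resolve_right hx0
    obtain ⟨c, hc⟩ := Nat.pow_sub_one_dvd_pow_sub_one (residueFieldCard F) hEa
    have h2 : x ^ ((residueFieldCard F) ^ a - 1) = 1 := by rw [hc, pow_mul, h1, one_pow]
    calc x ^ ((residueFieldCard F) ^ a) = x ^ ((residueFieldCard F) ^ a - 1) * x := by rw [← pow_succ, Nat.sub_add_cancel hqa]
      _ = x := by rw [h2, one_mul]
  calc ρ x = ρ (ω ^ i) := by rw [hix]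
    _ = (ω ^ ((residueFieldCard F) ^ a)) ^ i := by rw [map_pow, hρω]
    _ = (ω ^ i) ^ ((residueFieldCard F) ^ a) := by rw [← pow_mul, ← pow_mul, mul_comm]
    _ = x := by rw [hix, hxa]

end Literature.NumberTheory.GaloisRepresentations
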